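import Literature.Topology.PlaneTopology.LocallyConnectedContinua
import Mathlib.Analysis.Complex.BranchLogRoot
import Mathlib.Analysis.SpecialFunctions.Pow.Complex
import Mathlib.Analysis.Convex.Contractible
import Mathlib.Analysis.Normed.Module.Convex
import HarnessLib

/-!
# Continua and the squaring map (plane topology)

Support for Carathéodory-type boundary theorems for conformal maps onto complements of curves
running to `∞` (`Literature.Probability.RandomPlanarGeometry.ArmComplementBoundary`), where the
unbounded target is made bounded by Koebe's square-root trick followed by a Möbius inversion, so
that the relevant boundary set is the preimage of a curve under `w ↦ w²`.

* `isCompact_setOf_sq_mem`: the preimage `{w | w² ∈ N}` of a compact set is compact;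
  `isPreconnected_setOf_sq_mem`: the preimage of a *continuum containing the branch point `0`* is
  connected (a clopen piece `A ∋ 0` of the preimage yields the symmetric pieces
  `{w, -w ∈ A}` and its complement, whose images are disjoint closed sets covering `N`);
  `exists_continuum_sq_lift`: a small continuum `τ` *away from* `0` (inside the disc
  `|u - w²| ≤ ε`, `√ε < |w|`) lifts to a small continuum through `w` (push `τ` through a continuous
  branch of `√·` on the disc `|u - w²| < |w|²`, Mathlib's `Complex.exists_continuousOn_pow_eq`; the
  lift stays in the disc `|v - w| ≤ √ε` because `|v - w| |v + w| = |v² - w²| ≤ ε` forces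
  `|v - w| ≤ √ε` or `|v + w| ≤ √ε`, and the two alternatives are separated).
* `IsUniformlyLocallyConnected.setOf_sq_mem_image_Icc` — **the preimage under `w ↦ w²` of a
  compact curve passing through `0` is uniformly locally connected**
  (`Literature.Topology.PlaneTopology.IsUniformlyLocallyConnected`): two nearby points of the
  preimage are joined, near `0`, by the (connected) preimage of two small sub-continua of the curve
  through `0`, and away from `0` by a lifted small sub-continuum.

These are routine point-set facts (Newman, *Elements of the topology of plane sets of points*
(1951), Ch. IV–V; Whyburn, *Analytic Topology* (1942), Ch. X on the lifting of locally connected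
continua under light open maps); no single source is followed.

## Mathlib

We USE `Complex.exists_continuousOn_pow_eq` (continuous roots on simply connected open sets),
`Convex.contractibleSpace` (discs are simply connected), `isPreconnected_iff_subset_of_disjoint_closed`,
`IsPreconnected.subset_left_of_subset_union`, `isCompact_of_isClosed_isBounded`.
-/

noncomputable section

open Set Filter Metric Topology

namespace Literature.Topology.PlaneTopology

/-! ### Preimages under the squaring map -/

/-- If `|v² - w²| ≤ ε` then `|v - w| ≤ √ε` or `|v + w| ≤ √ε` (as `|v - w| |v + w| = |v² - w²|`).
[folklore] -/
theorem norm_sub_le_sqrt_or_norm_add_le_sqrt {v w : ℂ} {ε : ℝ} (hε : 0 ≤ ε)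
    (h : ‖v ^ 2 - w ^ 2‖ ≤ ε) : ‖v - w‖ ≤ Real.sqrt ε ∨ ‖v + w‖ ≤ Real.sqrt ε := by
  by_contra hcon
  push Not at hcon
  have heq : v ^ 2 - w ^ 2 = (v - w) * (v + w) := by ring
  rw [heq, norm_mul] at h
  have : ε < ‖v - w‖ * ‖v + w‖ :=
    calc ε = Real.sqrt ε * Real.sqrt ε := (Real.mul_self_sqrt hε).symm
      _ < ‖v - w‖ * ‖v + w‖ :=
        mul_lt_mul'' hcon.1 hcon.2 (Real.sqrt_nonneg _) (Real.sqrt_nonneg _)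
  linarith

/-- A bound for square roots: if `|w²| ≤ R` then `|w| ≤ max 1 R`. [folklore] -/
theorem norm_le_max_one_of_norm_sq_le {w : ℂ} {R : ℝ} (h : ‖w ^ 2‖ ≤ R) : ‖w‖ ≤ max 1 R := by
  by_contra hlt
  push Not at hlt
  have h1 : 1 < ‖w‖ := lt_of_le_of_lt (le_max_left _ _) hlt
  have h2 : ‖w‖ ≤ ‖w‖ ^ 2 := by nlinarith
  rw [norm_pow] at h
  linarith [le_max_right 1 R]

/-- **The preimage of a compact set under `w ↦ w²` is compact.** [folklore] -/
theorem isCompact_setOf_sq_mem {N : Set ℂ} (hN : IsCompact N) : IsCompact {w : ℂ | w ^ 2 ∈ N} := by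
  obtain ⟨R, hR⟩ := hN.isBounded.subset_closedBall 0
  refine isCompact_of_isClosed_isBounded (hN.isClosed.preimage (continuous_pow 2)) ?_
  refine (isBounded_closedBall (x := (0 : ℂ)) (r := max 1 R)).subset fun w hw ↦ ?_
  exact mem_closedBall_zero_iff.2
    (norm_le_max_one_of_norm_sq_le (mem_closedBall_zero_iff.1 (hR hw)))

/-- Every complex number is a square. [folklore] -/
theorem exists_sq_eq (z : ℂ) : ∃ w : ℂ, w ^ 2 = z :=
  ⟨z ^ (2⁻¹ : ℂ), by exact_mod_cast Complex.cpow_nat_inv_pow z two_ne_zero⟩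

/-- **The preimage under `w ↦ w²` of a continuum containing the branch point `0` is connected.**
If `N` is compact, preconnected and `0 ∈ N`, then `{w | w² ∈ N}` is preconnected: were it covered
by disjoint closed `u ∋ 0` and `v`, the symmetrised pieces `A = {w, -w ∈ u}` and
`B = {w ∈ v or -w ∈ v}` would have disjoint compact images covering `N`, with `0` in the first;
so `N` misses the second, `B = ∅`, and the preimage lies in `u`. [folklore] -/
theorem isPreconnected_setOf_sq_mem {N : Set ℂ} (hN : IsCompact N) (hNc : IsPreconnected N)
    (h0 : (0 : ℂ) ∈ N) : IsPreconnected {w : ℂ | w ^ 2 ∈ N} := by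
  set M : Set ℂ := {w : ℂ | w ^ 2 ∈ N} with hM
  have hMK : IsCompact M := isCompact_setOf_sq_mem hN
  have hneg : ∀ w : ℂ, w ∈ M → -w ∈ M := fun w hw ↦ by
    simp only [hM, mem_setOf_eq, neg_sq] at hw ⊢
    exact hw
  have h0M : (0 : ℂ) ∈ M := by simp [hM, h0]
  -- the symmetric core of the argument: a closed cover `u ∋ 0`, `v` with `M ∩ u ∩ v = ∅` has `M ⊆ u`
  have key : ∀ u v : Set ℂ, IsClosed u → IsClosed v → M ⊆ u ∪ v → M ∩ (u ∩ v) = ∅ → (0 : ℂ) ∈ u →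
      M ⊆ u := by
    intro u v hu hv hMuv hdisj h0u
    have hnot : ∀ x ∈ M, x ∈ u → x ∈ v → False := fun x hx hxu hxv ↦ by
      have : x ∈ M ∩ (u ∩ v) := ⟨hx, hxu, hxv⟩
      rw [hdisj] at this
      exact this
    set A : Set ℂ := {w ∈ M | w ∈ u ∧ -w ∈ u} with hA
    set B : Set ℂ := {w ∈ M | w ∈ v ∨ -w ∈ v} with hB
    have hAK : IsCompact A := hMK.inter_right (hu.inter (hu.preimage continuous_neg))
    have hBK : IsCompact B := hMK.inter_right (hv.union (hv.preimage continuous_neg))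
    have hcover : N ⊆ (fun w : ℂ ↦ w ^ 2) '' A ∪ (fun w : ℂ ↦ w ^ 2) '' B := by
      intro z hz
      obtain ⟨w, hw⟩ := exists_sq_eq z
      have hwM : w ∈ M := by simp [hM, hw, hz]
      rcases hMuv hwM with hwu | hwv
      · rcases hMuv (hneg w hwM) with hnu | hnv
        · exact Or.inl ⟨w, ⟨hwM, hwu, hnu⟩, hw⟩
        · exact Or.inr ⟨w, ⟨hwM, Or.inr hnv⟩, hw⟩
      · exact Or.inr ⟨w, ⟨hwM, Or.inl hwv⟩, hw⟩
    have hdisj' : N ∩ ((fun w : ℂ ↦ w ^ 2) '' A ∩ (fun w : ℂ ↦ w ^ 2) '' B) = ∅ := by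
      refine eq_empty_iff_forall_notMem.2 ?_
      rintro z ⟨-, ⟨a, ⟨haM, hau, hnau⟩, rfl⟩, ⟨b, ⟨-, hb⟩, hab⟩⟩
      rcases sq_eq_sq_iff_eq_or_eq_neg.1 hab with rfl | rfl
      · rcases hb with hbv | hnbv
        · exact hnot _ haM hau hbv
        · exact hnot _ (hneg _ haM) hnau hnbv
      · rcases hb with hbv | hnbv
        · exact hnot _ (hneg _ haM) hnau hbv
        · rw [neg_neg] at hnbv
          exact hnot _ haM hau hnbv
    have himA : IsClosed ((fun w : ℂ ↦ w ^ 2) '' A) := (hAK.image (continuous_pow 2)).isClosed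
    have himB : IsClosed ((fun w : ℂ ↦ w ^ 2) '' B) := (hBK.image (continuous_pow 2)).isClosed
    rcases (isPreconnected_iff_subset_of_disjoint_closed.1 hNc) _ _ himA himB hcover hdisj' with
      hNA | hNB
    · intro w hwM
      obtain ⟨a, ⟨-, hau, hnau⟩, hwa⟩ := hNA hwM
      rcases sq_eq_sq_iff_eq_or_eq_neg.1 hwa.symm with rfl | rfl
      · exact hau
      · exact hnau
    · exfalso
      obtain ⟨b, ⟨hbM, hb⟩, hb0⟩ := hNB h0
      have : b = 0 := by simpa using hb0
      subst this
      rw [neg_zero, or_self] at hb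
      exact hnot 0 hbM h0u hb
  rw [isPreconnected_iff_subset_of_disjoint_closed]
  intro u v hu hv hMuv hdisj
  rcases hMuv h0M with h0u | h0v
  · exact Or.inl (key u v hu hv hMuv hdisj h0u)
  · refine Or.inr (key v u hv hu (by rwa [union_comm]) (by rwa [inter_comm v u]) h0v)

/-- **Lifting a small continuum away from the branch point.** Let `τ` be a compact preconnected
set with `w² ∈ τ ⊆ {|u - w²| ≤ ε}` and `√ε < |w|`. Then there is a compact preconnected `τ'` with
`w ∈ τ' ⊆ {|v - w| ≤ √ε}`, squaring into `τ`, and onto: every point of `τ` is the square of a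
point of `τ'`. (`τ'` is the image of `τ` under the branch of `√·` on the disc `|u - w²| < |w|²`
taking `w² ↦ w`; it lies in `{|v - w| ≤ √ε} ∪ {|v + w| ≤ √ε}`, two separated discs, and meets
the first.) [folklore] -/
theorem exists_continuum_sq_lift {τ : Set ℂ} {w : ℂ} {ε : ℝ} (hτK : IsCompact τ)
    (hτc : IsPreconnected τ) (hwτ : w ^ 2 ∈ τ) (hτε : τ ⊆ closedBall (w ^ 2) ε) (hε : 0 ≤ ε)
    (hεw : Real.sqrt ε < ‖w‖) :
    ∃ τ' : Set ℂ, IsCompact τ' ∧ IsPreconnected τ' ∧ w ∈ τ' ∧ (∀ v ∈ τ', v ^ 2 ∈ τ) ∧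
      τ' ⊆ closedBall w (Real.sqrt ε) ∧ ∀ u ∈ τ, ∃ v ∈ τ', v ^ 2 = u := by
  have hw0 : w ≠ 0 := by
    rintro rfl
    rw [norm_zero] at hεw
    exact absurd hεw (not_lt.2 (Real.sqrt_nonneg ε))
  have hwpos : 0 < ‖w‖ := norm_pos_iff.2 hw0
  have hεw2 : ε < ‖w‖ ^ 2 := (Real.sqrt_lt' hwpos).1 hεw
  set B : Set ℂ := ball (w ^ 2) (‖w‖ ^ 2) with hB
  have hB0 : (0 : ℂ) ∉ B := by
    simp [hB, mem_ball, dist_eq_norm, norm_pow]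
  have hτB : τ ⊆ B := fun u hu ↦ by
    have := hτε hu
    rw [mem_closedBall] at this
    rw [hB, mem_ball]
    linarith
  have hBsc : IsSimplyConnected B := by
    have : ContractibleSpace B :=
      (convex_ball _ _).contractibleSpace ⟨w ^ 2, mem_ball_self (by positivity)⟩
    change SimplyConnectedSpace B
    infer_instance
  obtain ⟨f, hfc, hf⟩ := Complex.exists_continuousOn_pow_eq hBsc isOpen_ball continuousOn_id
    (by rintro ⟨z, hz, hz0⟩; rw [id_eq] at hz0; rw [hz0] at hz; exact hB0 hz) two_ne_zero
  simp only [id_eq] at hf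
  -- normalise the sign so that `w² ↦ w`
  have hfw : f (w ^ 2) ^ 2 = w ^ 2 := hf _
  have hfw0 : f (w ^ 2) ≠ 0 := by
    intro h
    rw [h, zero_pow two_ne_zero] at hfw
    exact hw0 (by simpa using hfw.symm)
  set c : ℂ := w / f (w ^ 2) with hc
  have hc2 : c ^ 2 = 1 := by
    rw [hc, div_pow, hfw, div_self (pow_ne_zero 2 hw0)]
  set g : ℂ → ℂ := fun u ↦ c * f u with hg
  have hgsq : ∀ u, g u ^ 2 = u := fun u ↦ by
    simp only [hg, mul_pow, hc2, hf, one_mul]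
  have hgw : g (w ^ 2) = w := by
    simp only [hg, hc, div_mul_cancel₀ _ hfw0]
  have hgc : ContinuousOn g τ := (continuousOn_const.mul hfc).mono hτB
  have himc : IsPreconnected (g '' τ) := hτc.image _ hgc
  have hwim : w ∈ g '' τ := ⟨w ^ 2, hwτ, hgw⟩
  have hsmall : ∀ u ∈ τ, ‖g u ^ 2 - w ^ 2‖ ≤ ε := fun u hu ↦ by
    rw [hgsq, ← dist_eq_norm]
    exact hτε hu
  -- separation of the two discs
  set ρ' : ℝ := (Real.sqrt ε + ‖w‖) / 2 with hρ'
  have hρ'1 : Real.sqrt ε < ρ' := by rw [hρ']; linarith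
  have hρ'2 : ρ' < ‖w‖ := by rw [hρ']; linarith
  have hsub : g '' τ ⊆ ball w ρ' ∪ ball (-w) ρ' := by
    rintro _ ⟨u, hu, rfl⟩
    rcases norm_sub_le_sqrt_or_norm_add_le_sqrt hε (hsmall u hu) with h | h
    · left
      rw [mem_ball, dist_eq_norm]
      linarith
    · right
      rw [mem_ball, dist_eq_norm, sub_neg_eq_add]
      linarith
  have hdisj : Disjoint (ball w ρ') (ball (-w) ρ') := by
    apply ball_disjoint_ball
    rw [dist_eq_norm, sub_neg_eq_add, ← two_mul, ← two_mul, norm_mul, Complex.norm_two]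
    linarith
  have hleft : g '' τ ⊆ ball w ρ' :=
    himc.subset_left_of_subset_union isOpen_ball isOpen_ball hdisj hsub
      ⟨w, hwim, mem_ball_self (lt_of_le_of_lt (Real.sqrt_nonneg ε) hρ'1)⟩
  refine ⟨g '' τ, hτK.image_of_continuousOn hgc, himc, hwim, ?_, ?_,
    fun u hu ↦ ⟨g u, ⟨u, hu, rfl⟩, hgsq u⟩⟩
  · rintro _ ⟨u, hu, rfl⟩
    rw [hgsq]
    exact hu
  · rintro _ ⟨u, hu, rfl⟩
    rcases norm_sub_le_sqrt_or_norm_add_le_sqrt hε (hsmall u hu) with h | h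
    · rwa [mem_closedBall, dist_eq_norm]
    · exfalso
      have hvb : g u ∈ ball w ρ' := hleft ⟨u, hu, rfl⟩
      rw [mem_ball, dist_eq_norm] at hvb
      have : ‖(2 : ℂ) * w‖ ≤ ‖g u + w‖ + ‖g u - w‖ :=
        calc ‖(2 : ℂ) * w‖ = ‖(g u + w) - (g u - w)‖ := by ring_nf
          _ ≤ ‖g u + w‖ + ‖g u - w‖ := norm_sub_le _ _
      rw [norm_mul, Complex.norm_two] at this
      linarith

/-! ### The preimage of a curve through the branch point is uniformly locally connected -/

/-- **The preimage under `w ↦ w²` of a compact curve through `0` is uniformly locally connected.**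
Let `P = c '' [a, b]` with `c` continuous on `[a, b]` and `0 ∈ P`. Given `ε > 0`: two points
`w, w'` of `{w | w² ∈ P}` that are close and *near `0`* are joined by the preimage of the union of
two small sub-continua of `P` joining `w²`, `w'²` to `0` (connected by
`isPreconnected_setOf_sq_mem`, small because it squares into a small disc about `0`); close points
*away from `0`* have close squares, joined by a small sub-continuum of `P`, which lifts to a small
continuum through `w` containing `w'` (`exists_continuum_sq_lift`; the lift contains `w'` rather
than `-w'` because `|w' + w|` is large). [folklore] -/
theorem IsUniformlyLocallyConnected.setOf_sq_mem_image_Icc {c : ℝ → ℂ} {a b : ℝ}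
    (hc : ContinuousOn c (Icc a b)) (h0 : (0 : ℂ) ∈ c '' Icc a b) :
    IsUniformlyLocallyConnected {w : ℂ | w ^ 2 ∈ c '' Icc a b} := by
  set P : Set ℂ := c '' Icc a b with hP
  have hPK : IsCompact P := isCompact_Icc.image_of_continuousOn hc
  have hPulc : IsUniformlyLocallyConnected P := IsUniformlyLocallyConnected.of_image_Icc hc
  obtain ⟨R, hR⟩ := hPK.isBounded.subset_closedBall 0
  set K : ℝ := max 1 R with hK
  have hKpos : 0 < K := lt_of_lt_of_le one_pos (le_max_left _ _)
  have hnormK : ∀ w : ℂ, w ^ 2 ∈ P → ‖w‖ ≤ K := fun w hw ↦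
    norm_le_max_one_of_norm_sq_le (mem_closedBall_zero_iff.1 (hR hw))
  intro ε hε
  -- scales
  set ε₃ : ℝ := ε ^ 2 / 16 with hε₃
  obtain ⟨δ₃, hδ₃, h₃⟩ := hPulc ε₃ (by positivity)
  set ϑ : ℝ := min (ε / 4) (Real.sqrt δ₃ / 3) with hϑ
  have hϑpos : 0 < ϑ := by positivity
  have hϑε : ϑ ≤ ε / 4 := min_le_left _ _
  have hϑδ : (2 * ϑ) ^ 2 < δ₃ := by
    have h1 : ϑ ≤ Real.sqrt δ₃ / 3 := min_le_right _ _
    have h2 : Real.sqrt δ₃ ^ 2 = δ₃ := Real.sq_sqrt hδ₃.le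
    nlinarith [Real.sqrt_nonneg δ₃, Real.sqrt_pos.2 hδ₃]
  set ε₄ : ℝ := min (ϑ ^ 2 / 2) (ε ^ 2) with hε₄
  have hε₄pos : 0 < ε₄ := by positivity
  obtain ⟨δ₄, hδ₄, h₄⟩ := hPulc ε₄ hε₄pos
  refine ⟨min (ϑ / 2) (δ₄ / (2 * K + 1)), by positivity, fun w hw w' hw' hd ↦ ?_⟩
  have hw2 : w ^ 2 ∈ P := hw
  have hw'2 : w' ^ 2 ∈ P := hw'
  have hdϑ : dist w w' < ϑ / 2 := lt_of_lt_of_le hd (min_le_left _ _)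
  have hdδ : dist w w' < δ₄ / (2 * K + 1) := lt_of_lt_of_le hd (min_le_right _ _)
  by_cases hsmall : ‖w‖ ≤ ϑ
  · -- **near the branch point**
    have hw'n : ‖w'‖ ≤ 2 * ϑ := by
      have h1 : ‖w'‖ ≤ ‖w‖ + dist w w' := by
        rw [dist_comm, dist_eq_norm]; exact norm_le_norm_add_norm_sub' w' w
      linarith
    have hsq0 : ∀ v : ℂ, ‖v‖ ≤ 2 * ϑ → dist (v ^ 2) 0 < δ₃ := fun v hv ↦ by
      rw [dist_zero_right, norm_pow]
      exact lt_of_le_of_lt (pow_le_pow_left₀ (norm_nonneg _) hv 2) hϑδ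
    obtain ⟨τ₀, hτ₀P, hτ₀K, hτ₀c, hwτ₀, h0τ₀, hτ₀B⟩ :=
      h₃ (w ^ 2) hw2 0 h0 (hsq0 w (by linarith))
    obtain ⟨τ₁, hτ₁P, hτ₁K, hτ₁c, hw'τ₁, h0τ₁, hτ₁B⟩ := h₃ (w' ^ 2) hw'2 0 h0 (hsq0 w' hw'n)
    have hτK : IsCompact (τ₀ ∪ τ₁) := hτ₀K.union hτ₁K
    have hτc : IsPreconnected (τ₀ ∪ τ₁) := hτ₀c.union 0 h0τ₀ h0τ₁ hτ₁c
    refine ⟨{v : ℂ | v ^ 2 ∈ τ₀ ∪ τ₁}, fun v hv ↦ (union_subset hτ₀P hτ₁P) hv,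
      isCompact_setOf_sq_mem hτK, isPreconnected_setOf_sq_mem hτK hτc (Or.inl h0τ₀),
      Or.inl hwτ₀, Or.inr hw'τ₁, fun v hv ↦ ?_⟩
    -- size: `|v²| ≤ 4ϑ² + ε₃ ≤ 5ε²/16`, so `|v| ≤ 3ε/4` and `|v - w| ≤ ε`
    have hv2 : ‖v ^ 2‖ ≤ (2 * ϑ) ^ 2 + ε₃ := by
      rcases hv with hv | hv
      · have h1 : dist (v ^ 2) (w ^ 2) ≤ ε₃ := hτ₀B hv
        calc ‖v ^ 2‖ ≤ ‖w ^ 2‖ + dist (v ^ 2) (w ^ 2) := by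
              rw [dist_eq_norm]; exact norm_le_norm_add_norm_sub' (v ^ 2) (w ^ 2)
          _ ≤ (2 * ϑ) ^ 2 + ε₃ := by
              rw [norm_pow]
              exact add_le_add (pow_le_pow_left₀ (norm_nonneg _) (by linarith) 2) h1
      · have h1 : dist (v ^ 2) (w' ^ 2) ≤ ε₃ := hτ₁B hv
        calc ‖v ^ 2‖ ≤ ‖w' ^ 2‖ + dist (v ^ 2) (w' ^ 2) := by
              rw [dist_eq_norm]; exact norm_le_norm_add_norm_sub' (v ^ 2) (w' ^ 2)
          _ ≤ (2 * ϑ) ^ 2 + ε₃ := by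
              rw [norm_pow]
              exact add_le_add (pow_le_pow_left₀ (norm_nonneg _) hw'n 2) h1
    have hv3 : ‖v‖ ≤ 3 * ε / 4 := by
      have h1 : ‖v‖ ^ 2 ≤ (3 * ε / 4) ^ 2 := by
        rw [← norm_pow]
        refine hv2.trans ?_
        rw [hε₃]
        nlinarith
      exact (pow_le_pow_iff_left₀ (norm_nonneg _) (by positivity) two_ne_zero).1 h1
    rw [mem_closedBall, dist_eq_norm]
    calc ‖v - w‖ ≤ ‖v‖ + ‖w‖ := norm_sub_le _ _
      _ ≤ 3 * ε / 4 + ϑ := add_le_add hv3 hsmall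
      _ ≤ ε := by linarith
  · -- **away from the branch point**
    push Not at hsmall
    have hsq : dist (w ^ 2) (w' ^ 2) < δ₄ := by
      rw [dist_eq_norm, show w ^ 2 - w' ^ 2 = (w - w') * (w + w') by ring, norm_mul]
      have h1 : ‖w + w'‖ ≤ 2 * K :=
        (norm_add_le _ _).trans (by linarith [hnormK w hw2, hnormK w' hw'2])
      have h2 : ‖w - w'‖ < δ₄ / (2 * K + 1) := by rwa [← dist_eq_norm]
      calc ‖w - w'‖ * ‖w + w'‖ ≤ δ₄ / (2 * K + 1) * (2 * K) :=
            mul_le_mul h2.le h1 (norm_nonneg _) (by positivity)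
        _ < δ₄ := by
            rw [div_mul_eq_mul_div, div_lt_iff₀ (by positivity)]
            nlinarith
    obtain ⟨τ, hτP, hτK, hτc, hwτ, hw'τ, hτB⟩ := h₄ (w ^ 2) hw2 (w' ^ 2) hw'2 hsq
    have hε₄w : Real.sqrt ε₄ < ‖w‖ := by
      rw [Real.sqrt_lt' (hϑpos.trans hsmall)]
      have : ε₄ ≤ ϑ ^ 2 / 2 := min_le_left _ _
      nlinarith
    obtain ⟨τ', hτ'K, hτ'c, hwτ', hτ'sq, hτ'B, hτ'onto⟩ :=
      exists_continuum_sq_lift hτK hτc hwτ hτB hε₄pos.le hε₄w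
    have hsqrtε : Real.sqrt ε₄ ≤ ε := by
      rw [Real.sqrt_le_left hε.le]
      exact min_le_right _ _
    have hsqrtϑ : Real.sqrt ε₄ < ϑ := by
      rw [Real.sqrt_lt' hϑpos]
      have : ε₄ ≤ ϑ ^ 2 / 2 := min_le_left _ _
      nlinarith
    -- `w'` (not `-w'`) is in the lift
    have hw'τ' : w' ∈ τ' := by
      obtain ⟨v, hv, hvsq⟩ := hτ'onto (w' ^ 2) hw'τ
      rcases sq_eq_sq_iff_eq_or_eq_neg.1 hvsq with rfl | rfl
      · exact hv
      · exfalso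
        have h1 : ‖-w' - w‖ ≤ Real.sqrt ε₄ := by
          rw [← dist_eq_norm]; exact hτ'B hv
        have h2 : ‖(2 : ℂ) * w‖ ≤ ‖-w' - w‖ + ‖w - w'‖ :=
          calc ‖(2 : ℂ) * w‖ = ‖-(-w' - w) + (w - w')‖ := by ring_nf
            _ ≤ ‖-(-w' - w)‖ + ‖w - w'‖ := norm_add_le _ _
            _ = ‖-w' - w‖ + ‖w - w'‖ := by rw [norm_neg]
        rw [norm_mul, Complex.norm_two] at h2
        have h3 : ‖w - w'‖ < ϑ / 2 := by rwa [← dist_eq_norm]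
        linarith
    exact ⟨τ', fun v hv ↦ hτP (hτ'sq v hv), hτ'K, hτ'c, hwτ', hw'τ',
      hτ'B.trans (closedBall_subset_closedBall hsqrtε)⟩

end Literature.Topology.PlaneTopology
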